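import Mathlib

/-!
# Tier4/Line1/StrongApproximation — LINE L1, rung C1 of the cocompactness wall (I1-c): `𝔸_{k,f} = k + ∏_v 𝓞_v`

Blind re-derivation cell `pub-hodge-repro`, Tier 4 «prove the step» (README §9–§10), seat t4-L1-p1 (prover, gen 0),
rung C1 of t4-L1-p5's cut of the cocompactness wall R-c (I1c-rungs-sig.lean, lead S12717 «p1: take the first rung p5
posts», p5 S12785).  The docstring and statement are restated BYTE-IDENTICALLY from proofs/t4-L1-p5/I1c-rungs-sig.lean
L23–L29.  Mathlib only.  No `sorry`; axioms = the trio.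

THE MATHEMATICS.  For a finite adele `x` the set `S` of places with `x_v ∉ 𝓞_v` is finite (the restricted product).
At each `v ∈ S`, density of `k` in `k_v` and openness of `𝓞_v` give `a_v ∈ k` with `x_v − a_v ∈ 𝓞_v`.  Choose a
common denominator `d ∈ 𝓞_k ∖ 0` with `a_v = b_v / d` (`b_v ∈ 𝓞_k`), and let `e_v := ord_v(d)`.  The Chinese remainder
theorem in the Dedekind domain `𝓞_k` (`IsDedekindDomain.exists_forall_sub_mem_ideal`) over the finite set
`T = S ∪ {v ∣ d}` gives `y ∈ 𝓞_k` with `y ≡ b_v (mod 𝔭_v^{e_v})` for `v ∈ S` and `y ≡ 0 (mod 𝔭_v^{e_v})` for the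
other `v ∈ T`.  Then `a := y / d` works: for `v ∈ S`, `x_v − a = (x_v − a_v) + (b_v − y)/d` with
`v((b_v − y)/d) ≤ 1` (`intValuation_le_pow_iff_dvd`, `intValuation_eq_exp_neg_multiplicity`); for `v ∉ S`, `x_v ∈ 𝓞_v`
and `v(y/d) ≤ 1` (`y ∈ 𝔭_v^{e_v}` if `v ∣ d`, and `v(d) = 1` otherwise).

Nothing here says anything about the status of the Hodge conjecture for CM abelian varieties, which is NOT proved
(HC_CM is NOT proved by anyone in this repository).
-/

set_option autoImplicit false
noncomputable section
namespace Summit.Ventures.HodgeRepro.Tier4.Line1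
open NumberField IsDedekindDomain HeightOneSpectrum Topology
open scoped ENNReal

variable (k : Type) [Field k] [NumberField k]

/-- helper (proved): local approximation — for one place `v` and `y ∈ k_v`, a rational `a` with `y − a ∈ 𝓞_v`
(density of `k` in `k_v`, openness of `𝓞_v`). -/
theorem exists_rational_sub_mem_integers_local (v : HeightOneSpectrum (𝓞 k)) (y : v.adicCompletion k) :
    ∃ a : k, y - (algebraMap k (v.adicCompletion k) a) ∈ v.adicCompletionIntegers k := by
  have hopen : IsOpen ((fun z : v.adicCompletion k => y - z) ⁻¹'
      (v.adicCompletionIntegers k : Set (v.adicCompletion k))) :=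
    (Valued.isOpen_valuationSubring _).preimage (continuous_const.sub continuous_id)
  have hmem : y ∈ (fun z : v.adicCompletion k => y - z) ⁻¹'
      (v.adicCompletionIntegers k : Set (v.adicCompletion k)) := by
    show y - y ∈ v.adicCompletionIntegers k
    rw [sub_self]
    exact zero_mem _
  obtain ⟨a, ha⟩ := (HeightOneSpectrum.denseRange_algebraMap k v).exists_mem_open hopen ⟨y, hmem⟩
  exact ⟨a, ha⟩

/-- helper (proved): `y / d` is integral at `v` when `𝔭_v^{ord_v d}` divides `y`. -/
theorem valuation_div_le_one (v : HeightOneSpectrum (𝓞 k)) {y d : 𝓞 k} (hd : d ≠ 0)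
    (hdiv : v.asIdeal ^ (multiplicity v.asIdeal (Ideal.span {d})) ∣ Ideal.span {y}) :
    v.valuation k (algebraMap (𝓞 k) k y / algebraMap (𝓞 k) k d) ≤ 1 := by
  rw [map_div₀, valuation_of_algebraMap, valuation_of_algebraMap,
    div_le_one₀ (intValuation_ne_zero v d hd |>.bot_lt)]
  rw [intValuation_eq_exp_neg_multiplicity v hd]
  exact (intValuation_le_pow_iff_dvd v y _).mpr hdiv

/-- helper (proved): a rational `a` is in `𝓞_v` iff its `v`-adic valuation is `≤ 1`. -/
theorem valued_coe_le_one_iff (v : HeightOneSpectrum (𝓞 k)) (a : k) :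
    (algebraMap k (v.adicCompletion k) a) ∈ v.adicCompletionIntegers k ↔ v.valuation k a ≤ 1 := by
  rw [mem_adicCompletionIntegers]
  change Valued.v ((a : k) : v.adicCompletion k) ≤ 1 ↔ _
  rw [valuedAdicCompletion_eq_valuation']



/-- (C1, M–L, t4-L1-p1) STRONG APPROXIMATION: `𝔸_{k,f} = k + ∏_v 𝓞_v`.  Proof: only finitely many `v` have
`x_v ∉ 𝓞_v`; choose `N` with `x_v ∈ 𝔭_v^{-N} 𝓞_v` there; CRT (`IsDedekindDomain.exists_forall_sub_mem_ideal`) on the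
fractional ideal `I⁻¹`, `I = ∏_{v ∈ S} 𝔭_v^N`, gives `a ∈ I⁻¹ ⊆ k` with `x_v − a ∈ 𝓞_v` for `v ∈ S`; `a` is integral
outside `S`.  (Print: Cassels–Fröhlich II §15 / Weil BNT IV §2; the `k`-density of `k` in `𝔸_f` + openness of `∏ 𝓞_v`.) -/
theorem exists_rational_sub_mem_integers (x : FiniteAdeleRing (𝓞 k) k) :
    ∃ a : k, ∀ v : HeightOneSpectrum (𝓞 k),
      (x - algebraMap k (FiniteAdeleRing (𝓞 k) k) a) v ∈ v.adicCompletionIntegers k := by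
  classical
  -- the finite bad set `S`
  have hS : {v : HeightOneSpectrum (𝓞 k) | x v ∉ v.adicCompletionIntegers k}.Finite :=
    Filter.eventually_cofinite.mp x.eventually
  -- local approximants `a v` for every `v` (used on `S`)
  choose a ha using fun v : HeightOneSpectrum (𝓞 k) => exists_rational_sub_mem_integers_local k v (x v)
  -- a common denominator `d` for the `a v`, `v ∈ S`
  obtain ⟨d, hd⟩ := IsLocalization.exist_integer_multiples (nonZeroDivisors (𝓞 k)) hS.toFinset a
  have hd0 : (d : 𝓞 k) ≠ 0 := nonZeroDivisors.ne_zero d.2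
  -- the numerators `b v` with `a v = b v / d` on `S`
  choose b hb using fun v : hS.toFinset => hd v v.2
  -- the second finite set: the places dividing `d`
  have hT : {v : HeightOneSpectrum (𝓞 k) | v.valuation k (algebraMap (𝓞 k) k d) < 1}.Finite := by
    have := HeightOneSpectrum.Support.finite (𝓞 k) (algebraMap (𝓞 k) k d)⁻¹
    refine this.subset fun v hv => ?_
    show 1 < v.valuation k (algebraMap (𝓞 k) k d)⁻¹
    have hne : v.valuation k (algebraMap (𝓞 k) k d) ≠ 0 := by
      rw [(v.valuation k).ne_zero_iff]
      exact (map_ne_zero_iff _ (IsFractionRing.injective (𝓞 k) k)).mpr hd0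
    rw [map_inv₀, one_lt_inv₀ (zero_lt_iff.mpr hne)]
    exact hv
  -- the exponents `e v = ord_v d` and the CRT index set `T = S ∪ {v ∣ d}`
  set e : HeightOneSpectrum (𝓞 k) → ℕ := fun v => multiplicity v.asIdeal (Ideal.span {(d : 𝓞 k)}) with he
  set T : Finset (HeightOneSpectrum (𝓞 k)) := hS.toFinset ∪ hT.toFinset with hTdef
  have hprime : ∀ v ∈ T, Prime v.asIdeal := fun v _ => Ideal.prime_of_isPrime v.ne_bot v.isPrime
  have hcoprime : ∀ v ∈ T, ∀ w ∈ T, v ≠ w → v.asIdeal ≠ w.asIdeal :=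
    fun v _ w _ hvw h => hvw (HeightOneSpectrum.ext h)
  -- CRT: `y ≡ b v (mod 𝔭_v^{e v})` for `v ∈ S`, `y ≡ 0` for the other `v ∈ T`
  obtain ⟨y, hy⟩ := IsDedekindDomain.exists_forall_sub_mem_ideal (s := T) (fun v => v.asIdeal) e
    hprime hcoprime (fun v => if h : (v : HeightOneSpectrum (𝓞 k)) ∈ hS.toFinset then b ⟨v, h⟩ else 0)
  -- the rational element `a = y / d`
  refine ⟨algebraMap (𝓞 k) k y / algebraMap (𝓞 k) k d, fun v => ?_⟩
  have hcomp : (x - algebraMap k (FiniteAdeleRing (𝓞 k) k) (algebraMap (𝓞 k) k y / algebraMap (𝓞 k) k d)) v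
      = x v - algebraMap k (v.adicCompletion k) (algebraMap (𝓞 k) k y / algebraMap (𝓞 k) k d) := rfl
  rw [hcomp]
  by_cases hvS : v ∈ hS.toFinset
  · -- `v ∈ S`: `x v − a = (x v − a_v) + (a_v − a)`, the second in `𝓞_v` by the congruence
    have hvT : v ∈ T := Finset.mem_union_left _ hvS
    have hyv := hy v hvT
    rw [dif_pos hvS] at hyv
    have hav : a v = algebraMap (𝓞 k) k (b ⟨v, hvS⟩) / algebraMap (𝓞 k) k d := by
      have h1 := hb ⟨v, hvS⟩
      rw [Algebra.smul_def] at h1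
      rw [eq_div_iff ((map_ne_zero_iff _ (IsFractionRing.injective (𝓞 k) k)).mpr hd0), mul_comm]
      exact h1.symm
    have hsplit : x v - algebraMap k (v.adicCompletion k) (algebraMap (𝓞 k) k y / algebraMap (𝓞 k) k d) =
        (x v - algebraMap k (v.adicCompletion k) (a v)) +
          algebraMap k (v.adicCompletion k) (a v - algebraMap (𝓞 k) k y / algebraMap (𝓞 k) k d) := by
      rw [map_sub]
      ring
    rw [hsplit]
    refine add_mem (ha v) ?_
    rw [valued_coe_le_one_iff, hav, ← sub_div, ← map_sub]
    refine valuation_div_le_one k v hd0 ?_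
    rw [Ideal.dvd_span_singleton]
    have : b ⟨v, hvS⟩ - y = -(y - b ⟨v, hvS⟩) := by ring
    rw [this]
    exact neg_mem hyv
  · -- `v ∉ S`: `x v ∈ 𝓞_v` and `a = y / d` is integral at `v`
    have hxv : x v ∈ v.adicCompletionIntegers k := by
      by_contra h
      exact hvS (hS.mem_toFinset.mpr h)
    refine sub_mem hxv ?_
    rw [valued_coe_le_one_iff]
    by_cases hvT : v ∈ hT.toFinset
    · have hyv := hy v (Finset.mem_union_right _ hvT)
      rw [dif_neg hvS, sub_zero] at hyv
      exact valuation_div_le_one k v hd0 (Ideal.dvd_span_singleton.mpr hyv)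
    · have hvd : ¬ v.valuation k (algebraMap (𝓞 k) k d) < 1 := fun h => hvT (hT.mem_toFinset.mpr h)
      have hvd1 : v.valuation k (algebraMap (𝓞 k) k d) = 1 :=
        le_antisymm (valuation_le_one v d) (not_lt.mp hvd)
      rw [map_div₀, hvd1, div_one]
      exact valuation_le_one v y

end Summit.Ventures.HodgeRepro.Tier4.Line1
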